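import Mathlib

/-!
# THE TWO-FLAT ROWS, LAYERED (night-3 g27)

`proofs/NIGHT3-G27-PLD.md` §5.  The two sides of the row `(q, u)` of `U_{s₁,k₁} ⊕ U_{s₂,k₂} ⊕ U_{m,m}` decomposed by
the layer `δ` = the number of kept fat points in the chain and the position `x` = the fat rank of the `q`-set: with
`e = u − q`, a member of fat type with `c = c₁ + c₂ ≤ q` and corank `f + (m − (q − c))` contributes
`C(m, q−c)·C(f + (m − (q−c)), e) = Σ_δ C(m, e−δ)·C(m − (e−δ), q−c)·[u + q − m ≤ f + c]·C(f, δ)` (`member_term_eq`: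
Vandermonde along the kept points, then the multinomial symmetry `choose_mul_choose_sub_comm`), and a level-`u` set of
fat corank `f` carries `C(u,q)·C(m, u−f) = Σ_δ C(m, e−δ)·Σ_x C(m − (e−δ), q−x)·[f = x+δ]·C(x+δ, x)` `q`-subsets of its
basis (`slot_term_eq`).  The sources and slots of a layer over an interval of positions collapse to the fat types with
the conditions `lo ≤ c ≤ hi` / `lo + δ ≤ f ≤ hi + δ` (`layer_src_eq`, `layer_slot_eq`).  No `def`, no `instance`,
no notation.  Axioms: standard.
-/

namespace PercRepro

namespace TwoFlatPLD

open Finset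

/-- The multinomial symmetry `C(m, z)·C(m − z, t) = C(m, t)·C(m − t, z)` (both count `(Z, T)` with `#Z = z`, `#T = t`,
disjoint in `m` points; `0 = 0` when `z + t > m`). -/
theorem choose_mul_choose_sub_comm (m z t : ℕ) :
    m.choose z * (m - z).choose t = m.choose t * (m - t).choose z := by
  by_cases h : z + t ≤ m
  · have h1 := Nat.choose_mul (n := m) (k := z + t) (s := z) (by omega)
    have h2 := Nat.choose_mul (n := m) (k := z + t) (s := t) (by omega)
    rw [Nat.add_sub_cancel_left] at h1
    rw [Nat.add_sub_cancel] at h2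
    have h3 : (z + t).choose z = (z + t).choose t := by
      rw [Nat.choose_symm_add]
    rw [← h1, ← h2, h3]
  · have e1 : m.choose z * (m - z).choose t = 0 := by
      by_cases hz : z ≤ m
      · rw [Nat.choose_eq_zero_of_lt (show m - z < t by omega), mul_zero]
      · rw [Nat.choose_eq_zero_of_lt (by omega), zero_mul]
    have e2 : m.choose t * (m - t).choose z = 0 := by
      by_cases ht : t ≤ m
      · rw [Nat.choose_eq_zero_of_lt (show m - t < z by omega), mul_zero]
      · rw [Nat.choose_eq_zero_of_lt (by omega), zero_mul]
    rw [e1, e2]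

/-- **The member term, layered**: for `c ≤ q` and `z = q − c`,
`[u ≤ f + (m − z)]·C(m, z)·C(f + (m − z), u − q) = Σ_{δ ≤ u−q} C(m, u−q−δ)·C(m − (u−q−δ), z)·[u + q − m ≤ f + c]·C(f, δ)`
(and both sides vanish when `c > q`). -/
theorem member_term_eq (m q u f c : ℕ) :
    (if c ≤ q ∧ u ≤ f + (m - (q - c)) then m.choose (q - c) * (f + (m - (q - c))).choose (u - q) else 0) =
      ∑ δ ∈ range (u - q + 1), m.choose (u - q - δ) *
        ((m - (u - q - δ)).choose (q - c) * (if c ≤ q ∧ u + q - m ≤ f + c then f.choose δ else 0)) := by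
  by_cases hcq : c ≤ q
  · by_cases hzm : q - c ≤ m
    · -- the activity conditions agree
      have hact : (u ≤ f + (m - (q - c))) ↔ (u + q - m ≤ f + c) := by omega
      by_cases hu : u ≤ f + (m - (q - c))
      · rw [if_pos ⟨hcq, hu⟩]
        have hu' : u + q - m ≤ f + c := hact.1 hu
        simp only [hcq, hu', and_self, if_true]
        -- Vandermonde on `f + (m − z)`
        rw [Nat.add_choose_eq, Finset.Nat.sum_antidiagonal_eq_sum_range_succ
          (fun i j => f.choose i * (m - (q - c)).choose j), mul_sum]
        apply sum_congr rfl
        intro δ _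
        have key := choose_mul_choose_sub_comm m (q - c) (u - q - δ)
        calc m.choose (q - c) * (f.choose δ * (m - (q - c)).choose (u - q - δ))
            = (m.choose (q - c) * (m - (q - c)).choose (u - q - δ)) * f.choose δ := by ring
          _ = (m.choose (u - q - δ) * (m - (u - q - δ)).choose (q - c)) * f.choose δ := by rw [key]
          _ = _ := by ring
      · rw [if_neg (fun h => hu h.2)]
        have hu' : ¬ (u + q - m ≤ f + c) := fun h => hu (hact.2 h)
        symm
        apply sum_eq_zero
        intro δ _
        simp only [hu', and_false, if_false, mul_zero]
    · -- `z > m`: every binomial `C(·, z)` vanishes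
      rw [Nat.choose_eq_zero_of_lt (show m < q - c by omega)]
      simp only [zero_mul, ite_self]
      symm
      apply sum_eq_zero
      intro δ _
      rw [Nat.choose_eq_zero_of_lt (show m - (u - q - δ) < q - c by omega)]
      simp
  · rw [if_neg (fun h => hcq h.1)]
    symm
    apply sum_eq_zero
    intro δ _
    simp only [hcq, false_and, if_false, mul_zero]

/-- Collapsing a sum over `δ` with the constraint `f = x + δ`. -/
theorem sum_ite_eq_add (e f x : ℕ) (F : ℕ → ℕ) :
    (∑ δ ∈ range (e + 1), (if f = x + δ then F δ else 0)) =
      if x ≤ f ∧ f - x ≤ e then F (f - x) else 0 := by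
  by_cases h : x ≤ f ∧ f - x ≤ e
  · rw [if_pos h]
    rw [sum_eq_single_of_mem (f - x) (by rw [mem_range]; omega)]
    · rw [if_pos (by omega)]
    · intro δ _ hδ
      rw [if_neg (by omega)]
  · rw [if_neg h]
    apply sum_eq_zero
    intro δ hδ
    rw [mem_range] at hδ
    rw [if_neg (by omega)]

/-- **The slot term, layered**: for the level `u` and a fat corank `f`,
`C(u,q)·[f ≤ u]·C(m, u − f) = Σ_{δ ≤ e} C(m, e−δ)·Σ_{x ≤ q} C(m − (e−δ), q − x)·[f = x + δ]·C(x+δ, x)` (`e = u − q`). -/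
theorem slot_term_eq (m q u f : ℕ) (hqu : q ≤ u) :
    u.choose q * (if f ≤ u then m.choose (u - f) else 0) =
      ∑ δ ∈ range (u - q + 1), m.choose (u - q - δ) *
        ∑ x ∈ range (q + 1), (m - (u - q - δ)).choose (q - x) * (if f = x + δ then (x + δ).choose x else 0) := by
  -- swap and collapse the right side
  have hswap : (∑ δ ∈ range (u - q + 1), m.choose (u - q - δ) *
        ∑ x ∈ range (q + 1), (m - (u - q - δ)).choose (q - x) * (if f = x + δ then (x + δ).choose x else 0)) =
      ∑ x ∈ range (q + 1), ∑ δ ∈ range (u - q + 1),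
        (if f = x + δ then m.choose (u - q - δ) * (m - (u - q - δ)).choose (q - x) * (x + δ).choose x else 0) := by
    rw [sum_comm]
    apply sum_congr rfl
    intro x _
    rw [mul_sum]
    apply sum_congr rfl
    intro δ _
    split_ifs <;> ring
  rw [hswap]
  have hcoll : ∀ x ∈ range (q + 1), (∑ δ ∈ range (u - q + 1),
        (if f = x + δ then m.choose (u - q - δ) * (m - (u - q - δ)).choose (q - x) * (x + δ).choose x else 0)) =
      (if x ≤ f ∧ f - x ≤ u - q then
        m.choose (u - q - (f - x)) * (m - (u - q - (f - x))).choose (q - x) * f.choose x else 0) := by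
    intro x _
    rw [sum_ite_eq_add (u - q) f x (fun δ => m.choose (u - q - δ) * (m - (u - q - δ)).choose (q - x) * (x + δ).choose x)]
    split_ifs with h
    · rw [show x + (f - x) = f by omega]
    · rfl
  rw [sum_congr rfl hcoll]
  by_cases hfu : f ≤ u
  · rw [if_pos hfu]
    -- Vandermonde `C(u, q) = Σ_x C(f, x)·C(u − f, q − x)`
    have hV : u.choose q = ∑ x ∈ range (q + 1), f.choose x * (u - f).choose (q - x) := by
      conv_lhs => rw [show u = f + (u - f) by omega]
      rw [Nat.add_choose_eq, Finset.Nat.sum_antidiagonal_eq_sum_range_succ (fun i j => f.choose i * (u - f).choose j)]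
    rw [hV, sum_mul]
    apply sum_congr rfl
    intro x hx
    rw [mem_range] at hx
    by_cases hxf : x ≤ f
    · by_cases hfx : f - x ≤ u - q
      · rw [if_pos ⟨hxf, hfx⟩]
        have h1 := Nat.choose_mul (n := m) (k := u - f) (s := q - x) (by omega)
        have h2 := choose_mul_choose_sub_comm m (q - x) (u - f - (q - x))
        have h3 : u - f - (q - x) = u - q - (f - x) := by omega
        rw [h3] at h1 h2
        calc f.choose x * (u - f).choose (q - x) * m.choose (u - f)
            = (m.choose (u - f) * (u - f).choose (q - x)) * f.choose x := by ring
          _ = (m.choose (q - x) * (m - (q - x)).choose (u - q - (f - x))) * f.choose x := by rw [h1]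
          _ = (m.choose (u - q - (f - x)) * (m - (u - q - (f - x))).choose (q - x)) * f.choose x := by rw [h2]
          _ = _ := by ring
      · rw [if_neg (fun h => hfx h.2)]
        rw [Nat.choose_eq_zero_of_lt (show u - f < q - x by omega)]
        ring
    · rw [if_neg (fun h => hxf h.1), Nat.choose_eq_zero_of_lt (by omega)]
      ring
  · rw [if_neg hfu, mul_zero]
    symm
    apply sum_eq_zero
    intro x hx
    rw [mem_range] at hx
    rw [if_neg]
    omega

/-- The sources of a layer over an interval of positions, collapsed to the fat types. -/
theorem layer_src_eq (k₁ s₁ k₂ s₂ δ Θ lo hi : ℕ) (S : Finset ℕ) (hS : ∀ x, x ∈ S ↔ lo ≤ x ∧ x ≤ hi) :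
    (∑ x ∈ S, ∑ i₁ ∈ range (k₁ + 1), ∑ i₂ ∈ range (k₂ + 1), k₁.choose i₁ * k₂.choose i₂ *
        (if min i₁ s₁ + min i₂ s₂ = x ∧ Θ ≤ min (k₁ - i₁) s₁ + min (k₂ - i₂) s₂ + x then
          (min (k₁ - i₁) s₁ + min (k₂ - i₂) s₂).choose δ else 0)) =
      ∑ i₁ ∈ range (k₁ + 1), ∑ i₂ ∈ range (k₂ + 1), k₁.choose i₁ * k₂.choose i₂ *
        (if lo ≤ min i₁ s₁ + min i₂ s₂ ∧ min i₁ s₁ + min i₂ s₂ ≤ hi ∧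
            Θ ≤ min (k₁ - i₁) s₁ + min (k₂ - i₂) s₂ + (min i₁ s₁ + min i₂ s₂) then
          (min (k₁ - i₁) s₁ + min (k₂ - i₂) s₂).choose δ else 0) := by
  rw [sum_comm]
  apply sum_congr rfl
  intro i₁ _
  rw [sum_comm]
  apply sum_congr rfl
  intro i₂ _
  rw [← mul_sum]
  congr 1
  have h1 : ∀ x, (if min i₁ s₁ + min i₂ s₂ = x ∧ Θ ≤ min (k₁ - i₁) s₁ + min (k₂ - i₂) s₂ + x then
        (min (k₁ - i₁) s₁ + min (k₂ - i₂) s₂).choose δ else 0) =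
      if min i₁ s₁ + min i₂ s₂ = x then (if Θ ≤ min (k₁ - i₁) s₁ + min (k₂ - i₂) s₂ + x then
        (min (k₁ - i₁) s₁ + min (k₂ - i₂) s₂).choose δ else 0) else 0 := by
    intro x
    split_ifs <;> first | rfl | (exfalso; tauto)
  simp only [h1]
  rw [sum_ite_eq]
  by_cases hmem : min i₁ s₁ + min i₂ s₂ ∈ S
  · rw [if_pos hmem]
    rw [hS] at hmem
    split_ifs <;> first | rfl | (exfalso; omega)
  · rw [if_neg hmem]
    rw [hS] at hmem
    rw [if_neg]
    intro h
    exact hmem ⟨h.1, h.2.1⟩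

/-- The slots of a layer over an interval of positions, collapsed to the fat types. -/
theorem layer_slot_eq (k₁ s₁ k₂ s₂ δ lo hi : ℕ) (S : Finset ℕ) (hS : ∀ x, x ∈ S ↔ lo ≤ x ∧ x ≤ hi) :
    (∑ x ∈ S, ∑ i₁ ∈ range (k₁ + 1), ∑ i₂ ∈ range (k₂ + 1), k₁.choose i₁ * k₂.choose i₂ *
        (if min (k₁ - i₁) s₁ + min (k₂ - i₂) s₂ = x + δ then (x + δ).choose x else 0)) =
      ∑ i₁ ∈ range (k₁ + 1), ∑ i₂ ∈ range (k₂ + 1), k₁.choose i₁ * k₂.choose i₂ *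
        (if lo + δ ≤ min (k₁ - i₁) s₁ + min (k₂ - i₂) s₂ ∧ min (k₁ - i₁) s₁ + min (k₂ - i₂) s₂ ≤ hi + δ then
          (min (k₁ - i₁) s₁ + min (k₂ - i₂) s₂).choose δ else 0) := by
  rw [sum_comm]
  apply sum_congr rfl
  intro i₁ _
  rw [sum_comm]
  apply sum_congr rfl
  intro i₂ _
  rw [← mul_sum]
  congr 1
  set f := min (k₁ - i₁) s₁ + min (k₂ - i₂) s₂ with hf
  have h1 : ∀ x, (if f = x + δ then (x + δ).choose x else 0) = if f - δ = x then (if δ ≤ f then f.choose δ else 0) else 0 := by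
    intro x
    by_cases h : f = x + δ
    · rw [if_pos h, if_pos (by omega), if_pos (by omega), h, Nat.choose_symm_add]
    · rw [if_neg h]
      by_cases h' : f - δ = x
      · rw [if_pos h', if_neg (by omega)]
      · rw [if_neg h']
  simp only [h1]
  rw [sum_ite_eq]
  by_cases hmem : f - δ ∈ S
  · rw [if_pos hmem]
    rw [hS] at hmem
    split_ifs <;> first | rfl | (exfalso; omega)
  · rw [if_neg hmem]
    rw [hS] at hmem
    rw [if_neg]
    intro h
    exact hmem ⟨by omega, by omega⟩

/-- Inserting the position: `Σ_{x ≤ q} w x · [c = x ∧ P x]·v = [c ≤ q ∧ P c]·w c · v`. -/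
theorem sum_range_ite_pos (q c v : ℕ) (P : ℕ → Prop) [DecidablePred P] (w : ℕ → ℕ) :
    (∑ x ∈ range (q + 1), w x * (if c = x ∧ P x then v else 0)) = if c ≤ q ∧ P c then w c * v else 0 := by
  have h1 : ∀ x, w x * (if c = x ∧ P x then v else 0) = if c = x then (if P x then w x * v else 0) else 0 := by
    intro x
    by_cases h : c = x ∧ P x
    · rw [if_pos h, if_pos h.1, if_pos h.2]
    · rw [if_neg h, mul_zero]
      by_cases hc : c = x
      · rw [if_pos hc, if_neg (fun hP => h ⟨hc, hP⟩)]
      · rw [if_neg hc]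
  simp only [h1]
  rw [sum_ite_eq]
  by_cases hc : c ≤ q
  · rw [if_pos (by rw [mem_range]; omega)]
    split_ifs <;> first | rfl | (exfalso; tauto)
  · rw [if_neg (by rw [mem_range]; omega), if_neg (fun h => hc h.1)]


end TwoFlatPLD

end PercRepro
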